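import Literature.MathematicalPhysics.QuantumFieldTheory.Balaban1983to89.B8Eq191FlatTowerGram
import Literature.MathematicalPhysics.QuantumFieldTheory.Balaban1983to89.B8Eq119TwistedAxialRec

/-!
# `Balaban1983to89.B8Eq191FlatTowerGramRec` — [Balaban1984PropagatorsII] p. 235 ∕ [Balaban1985RegularSpaces] (1.91) p. 91 AT THE FLAT BACKGROUND: the Dirichlet matrix
# `Δ_{Ω₀} + Q′ᵀaQ′` is a unit and the tower Gram matrix `Q′G′²Q′ᵀ` is a unit, FOR AN ARBITRARY FAMILY OF BLOCK-LABEL MAPS `bm j` — hence for the RECORD's CENTRED labels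
# `flmZ L j` ([Balaban1987RG1] (0.3)); the record twin (by generalisation) of `B8Eq191FlatDirichletForm` §4–§5 and `B8Eq191FlatTowerGram` (R6, δ sub-chain)

statement-level skeleton of published theorems with citation tags; proofs where landed; nothing here is a claim about the Yang–Mills mass gap

CITATION HEADER (lean-in-tree rule).  Cell `pub-ymgap` (HUMAN RULING D-0062), «N05-REC» road (director-ym №254∕№255; LEAD PEN dag-n05-e g37; desk `R6-PLAN.md` §2 (d)).  [6] =
[Balaban1985RegularSpaces] (1.91) p. 91, (1.95) p. 92; [4] = [Balaban1985BackgroundPropagators] (3.19) p. 393, (3.23)–(3.25) p. 394; [B6] = [Balaban1984PropagatorsII] p. 235 («positive definite, so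
its inverse is well defined»); [I] = [Balaban1987RG1] (0.3) p. 252.  `--kind proof --supports stmt-QuantumFields-20541` (K0⁷; count-neutral; no definition).
WHY GENERAL `bm`.  The engine files prove definiteness of the flat Dirichlet form, symmetry of `G′(1)`, injectivity of `Q′(1)ᵀ` on disjoint towers and the unit property of `Q′G′²Q′ᵀ` with
the kernel written through the CORNER block labels `blockMap (Lʲ)`; every proof uses of the labels only that they are SOME maps `ℤᵈ → ℤᵈ` (the Gram lemma `quadForm_gram_nonneg` is already
stated for an arbitrary map).  This file re-runs the same proofs with `blockMap (Lʲ) ↦ bm j` arbitrary (§1–§5, names suffixed `_bm`), so that the RECORD's centred labels `bm j := flmZ L j`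
(dag-n05-d's `B8Eq119TwistedAxialRec.flmZ`; the kernel of `B8Eq191FlatStencilsRec.flatDirichletOpZ_eq_sum_of_supp`) are an instance (§6) — and so is the engine (`bm j := blockMap (Lʲ)`).
REUSED BY NAME: the engine's generic lemmas `B8Eq191FlatDirichletForm.{quadForm_lap_flat_nonneg, quadForm_lap_flat_eq, eq_zero_of_lapForm_eq_zero, quadForm_gram_nonneg}`.

WHAT IS PROVED (sorry-free).  §1 `eq_zero_of_quadForm_flat_eq_zero_bm` (the flat Dirichlet form with label maps `bm` is definite); §2 `flatMatrix_mulVec_injective_bm`, ★`isUnit_flatMatrix_bm`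
(existence of `G′(1) = (Δ_{Ω₀} + Q′ᵀaQ′)⁻¹`); §3 `flatKernel_symm_bm`, `flatMatrix_transpose_bm`, `flatMatrix_inv_transpose_bm`; §4 `towerQT_mulVec_injective_bm`; §5 ★`isUnit_towerGram_bm` (the
letter `C = (Q′G′²Q′ᵀ)⁻¹` exists); §6 THE RECORD INSTANCES `isUnit_flatMatrixZ`, `flatMatrixZ_inv_transpose`, `isUnit_towerGramZ` at `bm j := flmZ L j`.
HONEST SCOPE.  Finite real linear algebra; no estimate; nothing of [4]∕[6]∕[B6]∕[I] asserted beyond it; `HThm4Rec` UNDISCHARGED; N05 ∕ N07 NOT discharged; counts unmoved (typed 28∕28 ·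
discharged 8∕28); one finite 𝕋⁴ programme at fixed ε — nothing continuum ∕ ℝ⁴ ∕ OS ∕ mass gap ∕ Clay.  No `def`, no `instance`, no `notation`, no `sorry`.
-/

noncomputable section

namespace Literature.MathematicalPhysics.QuantumFieldTheory.Balaban1983to89.B8Eq191FlatTowerGramRec

open Finset
open scoped Matrix
open B7Prop1Explicit (e)
open B8Eq191FlatDirichletForm (quadForm_lap_flat_nonneg quadForm_lap_flat_eq eq_zero_of_lapForm_eq_zero quadForm_gram_nonneg)
open B8Eq119TwistedAxialRec (flmZ)

variable {d : ℕ}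

/-! ## §1 The whole form for a GENERAL family of block-label maps `bm j`: vanishing forces `v = 0` -/

open Classical in
/-- **THE FLAT DIRICHLET FORM IS DEFINITE**: with the kernel `K` of `B8Eq191FlatStencils.flatDirichletOp_eq_sum_of_supp` (`η ≠ 0`, level weights
`a_j ≥ 0`, `d ≥ 1`), for `v` supported in the finite `S`: `Σ_{x,z∈S} v(x)K(x,z)v(z) = 0 ⇒ v = 0`.
[cite: Balaban1984PropagatorsII, p.235 («positive definite, so its inverse is well defined»); Balaban1985BackgroundPropagators, (3.24)–(3.25) p.394; Balaban1985RegularSpaces, (1.91) p.91] -/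
theorem eq_zero_of_quadForm_flat_eq_zero_bm (hd : 0 < d) {η : ℝ} (hη : η ≠ 0) (L m : ℕ) (Λs : ℕ → Set (Fin d → ℤ)) (bm : ℕ → (Fin d → ℤ) → (Fin d → ℤ)) (a : ℕ → ℝ)
    (ha : ∀ j, 0 ≤ a j) (K : (Fin d → ℤ) → (Fin d → ℤ) → ℝ)
    (hK : ∀ x z, K x z = ((η ^ 2)⁻¹ * ∑ μ : Fin d, ((2 : ℝ) * (if z = x then (1 : ℝ) else 0) - (if z = x + e μ then (1 : ℝ) else 0)
        - (if z = x - e μ then (1 : ℝ) else 0))) +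
        (∑ j ∈ Finset.range (m + 1), (if bm j x ∈ Λs j ∧ bm j z = bm j x then
          a j * ((((L : ℝ) ^ d)⁻¹) ^ j) ^ 2 else 0)))
    (S : Finset (Fin d → ℤ)) (v : (Fin d → ℤ) → ℝ) (hv : ∀ w, w ∉ S → v w = 0)
    (h0 : ∑ x ∈ S, ∑ z ∈ S, v x * K x z * v z = 0) (w : Fin d → ℤ) : v w = 0 := by
  -- pointwise split of the summand
  have hterm : ∀ x z, v x * K x z * v z =
      (η ^ 2)⁻¹ * ∑ μ : Fin d, v x * ((2 : ℝ) * (if z = x then (1 : ℝ) else 0)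
        - (if z = x + e μ then (1 : ℝ) else 0) - (if z = x - e μ then (1 : ℝ) else 0)) * v z +
      ∑ j ∈ Finset.range (m + 1), v x * (if bm j x ∈ Λs j ∧ bm j z = bm j x
        then a j * ((((L : ℝ) ^ d)⁻¹) ^ j) ^ 2 else 0) * v z := by
    intro x z
    rw [hK, mul_add, add_mul]
    congr 1
    · simp only [Finset.mul_sum, Finset.sum_mul]
      exact Finset.sum_congr rfl fun μ _ => by ring
    · simp only [Finset.mul_sum, Finset.sum_mul]
  have hx : ∑ x ∈ S, ∑ z ∈ S, v x * K x z * v z =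
      ∑ x ∈ S, ∑ z ∈ S, ((η ^ 2)⁻¹ * ∑ μ : Fin d, v x * ((2 : ℝ) * (if z = x then (1 : ℝ) else 0)
        - (if z = x + e μ then (1 : ℝ) else 0) - (if z = x - e μ then (1 : ℝ) else 0)) * v z) +
      ∑ x ∈ S, ∑ z ∈ S, ∑ j ∈ Finset.range (m + 1), v x * (if bm j x ∈ Λs j ∧
        bm j z = bm j x then a j * ((((L : ℝ) ^ d)⁻¹) ^ j) ^ 2 else 0) * v z := by
    rw [← Finset.sum_add_distrib]
    refine Finset.sum_congr rfl fun x _ => ?_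
    rw [← Finset.sum_add_distrib]
    exact Finset.sum_congr rfl fun z _ => hterm x z
  have hA : ∑ x ∈ S, ∑ z ∈ S, ((η ^ 2)⁻¹ * ∑ μ : Fin d, v x * ((2 : ℝ) * (if z = x then (1 : ℝ) else 0)
        - (if z = x + e μ then (1 : ℝ) else 0) - (if z = x - e μ then (1 : ℝ) else 0)) * v z) =
      (η ^ 2)⁻¹ * ∑ μ : Fin d, ∑ x ∈ S, ∑ z ∈ S, v x * ((2 : ℝ) * (if z = x then (1 : ℝ) else 0)
        - (if z = x + e μ then (1 : ℝ) else 0) - (if z = x - e μ then (1 : ℝ) else 0)) * v z := by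
    simp_rw [← Finset.mul_sum]
    congr 1
    simp_rw [Finset.sum_comm (s := S) (t := (Finset.univ : Finset (Fin d)))]
  have hB : ∑ x ∈ S, ∑ z ∈ S, ∑ j ∈ Finset.range (m + 1), v x * (if bm j x ∈ Λs j ∧
        bm j z = bm j x then a j * ((((L : ℝ) ^ d)⁻¹) ^ j) ^ 2 else 0) * v z =
      ∑ j ∈ Finset.range (m + 1), ∑ x ∈ S, ∑ z ∈ S, v x * (if bm j x ∈ Λs j ∧
        bm j z = bm j x then a j * ((((L : ℝ) ^ d)⁻¹) ^ j) ^ 2 else 0) * v z := by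
    simp_rw [Finset.sum_comm (s := S) (t := Finset.range (m + 1))]
  have hsplit : ∑ x ∈ S, ∑ z ∈ S, v x * K x z * v z =
      (η ^ 2)⁻¹ * ∑ μ : Fin d, ∑ x ∈ S, ∑ z ∈ S, v x * ((2 : ℝ) * (if z = x then (1 : ℝ) else 0)
        - (if z = x + e μ then (1 : ℝ) else 0) - (if z = x - e μ then (1 : ℝ) else 0)) * v z +
      ∑ j ∈ Finset.range (m + 1), ∑ x ∈ S, ∑ z ∈ S, v x * (if bm j x ∈ Λs j ∧ bm j z = bm j x
        then a j * ((((L : ℝ) ^ d)⁻¹) ^ j) ^ 2 else 0) * v z := by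
    rw [hx, hA, hB]
  rw [hsplit] at h0
  have hlap : ∀ μ : Fin d, 0 ≤ ∑ x ∈ S, ∑ z ∈ S, v x * ((2 : ℝ) * (if z = x then (1 : ℝ) else 0)
      - (if z = x + e μ then (1 : ℝ) else 0) - (if z = x - e μ then (1 : ℝ) else 0)) * v z :=
    fun μ => quadForm_lap_flat_nonneg S v hv μ
  have hgram : ∀ j, 0 ≤ ∑ x ∈ S, ∑ z ∈ S, v x * (if bm j x ∈ Λs j ∧ bm j z = bm j x
      then a j * ((((L : ℝ) ^ d)⁻¹) ^ j) ^ 2 else 0) * v z :=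
    fun j => quadForm_gram_nonneg S v (bm j) (Λs j) (mul_nonneg (ha j) (sq_nonneg _))
  have hη2 : 0 < (η ^ 2)⁻¹ := inv_pos.mpr (by positivity)
  have h1 : 0 ≤ ∑ μ : Fin d, ∑ x ∈ S, ∑ z ∈ S, v x * ((2 : ℝ) * (if z = x then (1 : ℝ) else 0)
      - (if z = x + e μ then (1 : ℝ) else 0) - (if z = x - e μ then (1 : ℝ) else 0)) * v z := Finset.sum_nonneg fun μ _ => hlap μ
  have h2 : 0 ≤ ∑ j ∈ Finset.range (m + 1), ∑ x ∈ S, ∑ z ∈ S, v x * (if bm j x ∈ Λs j ∧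
      bm j z = bm j x then a j * ((((L : ℝ) ^ d)⁻¹) ^ j) ^ 2 else 0) * v z :=
    Finset.sum_nonneg fun j _ => hgram j
  have hsum0 : ∑ μ : Fin d, ∑ x ∈ S, ∑ z ∈ S, v x * ((2 : ℝ) * (if z = x then (1 : ℝ) else 0)
      - (if z = x + e μ then (1 : ℝ) else 0) - (if z = x - e μ then (1 : ℝ) else 0)) * v z = 0 := by
    nlinarith [mul_nonneg hη2.le h1]
  have hμ0 := (Finset.sum_eq_zero_iff_of_nonneg fun μ _ => hlap μ).mp hsum0 ⟨0, hd⟩ (Finset.mem_univ _)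
  rw [quadForm_lap_flat_eq S v hv ⟨0, hd⟩] at hμ0
  exact eq_zero_of_lapForm_eq_zero S v hv ⟨0, hd⟩ hμ0 w

/-! ## §2 The real matrix of the flat Dirichlet operator is a unit (general `bm`) -/

open Classical in
/-- **`mulVec` of the flat Dirichlet matrix `(K(x,z))_{x,z∈S}` is injective** (definite form ⇒ trivial kernel).
[cite: Balaban1984PropagatorsII, p.235; Balaban1985RegularSpaces, (1.91) p.91] -/
theorem flatMatrix_mulVec_injective_bm (hd : 0 < d) {η : ℝ} (hη : η ≠ 0) (L m : ℕ) (Λs : ℕ → Set (Fin d → ℤ)) (bm : ℕ → (Fin d → ℤ) → (Fin d → ℤ)) (a : ℕ → ℝ)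
    (ha : ∀ j, 0 ≤ a j) (K : (Fin d → ℤ) → (Fin d → ℤ) → ℝ)
    (hK : ∀ x z, K x z = ((η ^ 2)⁻¹ * ∑ μ : Fin d, ((2 : ℝ) * (if z = x then (1 : ℝ) else 0) - (if z = x + e μ then (1 : ℝ) else 0)
        - (if z = x - e μ then (1 : ℝ) else 0))) +
        (∑ j ∈ Finset.range (m + 1), (if bm j x ∈ Λs j ∧ bm j z = bm j x then
          a j * ((((L : ℝ) ^ d)⁻¹) ^ j) ^ 2 else 0)))
    (S : Finset (Fin d → ℤ)) :
    Function.Injective (Matrix.of fun x z : ↥S => K x.1 z.1).mulVec := by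
  intro u₁ u₂ h12
  set u : ↥S → ℝ := u₁ - u₂ with hu
  have hTu : (Matrix.of fun x z : ↥S => K x.1 z.1).mulVec u = 0 := by
    rw [hu, Matrix.mulVec_sub, h12, sub_self]
  -- the zero extension of `u`
  set v : (Fin d → ℤ) → ℝ := fun w => if hw : w ∈ S then u ⟨w, hw⟩ else 0 with hvdef
  have hv : ∀ w, w ∉ S → v w = 0 := fun w hw => by rw [hvdef]; exact dif_neg hw
  have hvS : ∀ x : ↥S, v x.1 = u x := fun x => by rw [hvdef]; exact dif_pos x.2
  have hform : ∑ x ∈ S, ∑ z ∈ S, v x * K x z * v z = 0 := by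
    rw [← Finset.sum_coe_sort S]
    have : ∀ x : ↥S, ∑ z ∈ S, v x.1 * K x.1 z * v z = u x * (Matrix.of fun x z : ↥S => K x.1 z.1).mulVec u x := by
      intro x
      rw [← Finset.sum_coe_sort S]
      simp only [Matrix.mulVec, dotProduct, Matrix.of_apply, Finset.mul_sum]
      exact Finset.sum_congr rfl fun z _ => by rw [hvS x, hvS z]; ring
    rw [Finset.sum_congr rfl fun x _ => this x, hTu]
    simp
  have hv0 : ∀ w, v w = 0 := eq_zero_of_quadForm_flat_eq_zero_bm hd hη L m Λs bm a ha K hK S v hv hform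
  have hu0 : u = 0 := funext fun x => by rw [← hvS x, hv0]; rfl
  rw [hu] at hu0
  exact sub_eq_zero.mp hu0

open Classical in
/-- **THE FLAT DIRICHLET MATRIX IS A UNIT** — the existence of `G′(1) = (Δ_{Ω₀} + Q′ᵀaQ′)⁻¹` at the flat background on a finite region.
[cite: Balaban1985RegularSpaces, (1.91) p.91, (1.95) p.92; Balaban1984PropagatorsII, p.235; Balaban1985BackgroundPropagators, (3.24)–(3.25) p.394] -/
theorem isUnit_flatMatrix_bm (hd : 0 < d) {η : ℝ} (hη : η ≠ 0) (L m : ℕ) (Λs : ℕ → Set (Fin d → ℤ)) (bm : ℕ → (Fin d → ℤ) → (Fin d → ℤ)) (a : ℕ → ℝ)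
    (ha : ∀ j, 0 ≤ a j) (K : (Fin d → ℤ) → (Fin d → ℤ) → ℝ)
    (hK : ∀ x z, K x z = ((η ^ 2)⁻¹ * ∑ μ : Fin d, ((2 : ℝ) * (if z = x then (1 : ℝ) else 0) - (if z = x + e μ then (1 : ℝ) else 0)
        - (if z = x - e μ then (1 : ℝ) else 0))) +
        (∑ j ∈ Finset.range (m + 1), (if bm j x ∈ Λs j ∧ bm j z = bm j x then
          a j * ((((L : ℝ) ^ d)⁻¹) ^ j) ^ 2 else 0)))
    (S : Finset (Fin d → ℤ)) :
    IsUnit (Matrix.of fun x z : ↥S => K x.1 z.1) :=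
  Matrix.mulVec_injective_iff_isUnit.mp (flatMatrix_mulVec_injective_bm hd hη L m Λs bm a ha K hK S)


/-! ## §3 Symmetry of the flat Dirichlet kernel and of `G′(1)` (general `bm`) -/

open Classical in
/-- **The flat Dirichlet kernel is symmetric**: `K(x, z) = K(z, x)`. [cite: Balaban1985BackgroundPropagators, (3.23)–(3.24) p.394] -/
theorem flatKernel_symm_bm {η : ℝ} (L m : ℕ) (Λs : ℕ → Set (Fin d → ℤ)) (bm : ℕ → (Fin d → ℤ) → (Fin d → ℤ)) (a : ℕ → ℝ) (K : (Fin d → ℤ) → (Fin d → ℤ) → ℝ)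
    (hK : ∀ x z, K x z = ((η ^ 2)⁻¹ * ∑ μ : Fin d, ((2 : ℝ) * (if z = x then (1 : ℝ) else 0) - (if z = x + e μ then (1 : ℝ) else 0)
        - (if z = x - e μ then (1 : ℝ) else 0))) +
        (∑ j ∈ Finset.range (m + 1), (if bm j x ∈ Λs j ∧ bm j z = bm j x then
          a j * ((((L : ℝ) ^ d)⁻¹) ^ j) ^ 2 else 0)))
    (x z : Fin d → ℤ) : K x z = K z x := by
  rw [hK, hK]
  congr 1
  · congr 1
    refine Finset.sum_congr rfl fun μ _ => ?_
    have h1 : (z = x) ↔ (x = z) := eq_comm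
    have h2 : (z = x + e μ) ↔ (x = z - e μ) := by
      constructor
      · intro h; rw [h, add_sub_cancel_right]
      · intro h; rw [h, sub_add_cancel]
    have h3 : (z = x - e μ) ↔ (x = z + e μ) := by
      constructor
      · intro h; rw [h, sub_add_cancel]
      · intro h; rw [h, add_sub_cancel_right]
    simp only [h1, h2, h3]
    ring
  · refine Finset.sum_congr rfl fun j _ => ?_
    by_cases h : bm j x ∈ Λs j ∧ bm j z = bm j x
    · rw [if_pos h, if_pos ⟨h.2 ▸ h.1, h.2.symm⟩]
    · rw [if_neg h, if_neg (fun h' : bm j z ∈ Λs j ∧ bm j x = bm j z =>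
        h ⟨h'.2 ▸ h'.1, h'.2.symm⟩)]

open Classical in
/-- The flat Dirichlet matrix is symmetric. [cite: Balaban1985BackgroundPropagators, (3.24) p.394] -/
theorem flatMatrix_transpose_bm {η : ℝ} (L m : ℕ) (Λs : ℕ → Set (Fin d → ℤ)) (bm : ℕ → (Fin d → ℤ) → (Fin d → ℤ)) (a : ℕ → ℝ) (K : (Fin d → ℤ) → (Fin d → ℤ) → ℝ)
    (hK : ∀ x z, K x z = ((η ^ 2)⁻¹ * ∑ μ : Fin d, ((2 : ℝ) * (if z = x then (1 : ℝ) else 0) - (if z = x + e μ then (1 : ℝ) else 0)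
        - (if z = x - e μ then (1 : ℝ) else 0))) +
        (∑ j ∈ Finset.range (m + 1), (if bm j x ∈ Λs j ∧ bm j z = bm j x then
          a j * ((((L : ℝ) ^ d)⁻¹) ^ j) ^ 2 else 0)))
    (S : Finset (Fin d → ℤ)) :
    (Matrix.of fun x z : ↥S => K x.1 z.1)ᵀ = Matrix.of fun x z : ↥S => K x.1 z.1 := by
  ext x z
  simp only [Matrix.transpose_apply, Matrix.of_apply]
  exact flatKernel_symm_bm L m Λs bm a K hK z.1 x.1

open Classical in
/-- **`G′(1)` is symmetric**: the inverse of the flat Dirichlet matrix is its own transpose. [cite: Balaban1985RegularSpaces, (1.95) p.92; Balaban1985BackgroundPropagators, (3.24) p.394] -/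
theorem flatMatrix_inv_transpose_bm {η : ℝ} (L m : ℕ) (Λs : ℕ → Set (Fin d → ℤ)) (bm : ℕ → (Fin d → ℤ) → (Fin d → ℤ)) (a : ℕ → ℝ) (K : (Fin d → ℤ) → (Fin d → ℤ) → ℝ)
    (hK : ∀ x z, K x z = ((η ^ 2)⁻¹ * ∑ μ : Fin d, ((2 : ℝ) * (if z = x then (1 : ℝ) else 0) - (if z = x + e μ then (1 : ℝ) else 0)
        - (if z = x - e μ then (1 : ℝ) else 0))) +
        (∑ j ∈ Finset.range (m + 1), (if bm j x ∈ Λs j ∧ bm j z = bm j x then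
          a j * ((((L : ℝ) ^ d)⁻¹) ^ j) ^ 2 else 0)))
    (S : Finset (Fin d → ℤ)) :
    ((Matrix.of fun x z : ↥S => K x.1 z.1)⁻¹)ᵀ = (Matrix.of fun x z : ↥S => K x.1 z.1)⁻¹ := by
  rw [Matrix.transpose_nonsing_inv, flatMatrix_transpose_bm L m Λs bm a K hK S]

/-! ## §4 The flat averaging matrix on the tower indices: `Qᵀ` is injective for disjoint towers (general `bm`) -/

/-- **`Q′(1)ᵀ` IS INJECTIVE ON THE TOWER SPACE** when the tower blocks indexed by `B` are pairwise disjoint on `S` and each meets `S`: with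
`Q(p, z) = L^{−dj}[y_j(z) = y]` for `p = (j, y) ∈ B`, `z ∈ S`, the map `u ↦ Qᵀu` has trivial kernel.
[cite: Balaban1985BackgroundPropagators, (3.19) p.393, (3.24) p.394; Balaban1984PropagatorsII, p.235] -/
theorem towerQT_mulVec_injective_bm {L : ℕ} (hL : 1 ≤ L) (bm : ℕ → (Fin d → ℤ) → (Fin d → ℤ)) (S : Finset (Fin d → ℤ)) (B : Finset (ℕ × (Fin d → ℤ)))
    (hmeet : ∀ p ∈ B, ∃ z ∈ S, bm p.1 z = p.2)
    (hdisj : ∀ p ∈ B, ∀ p' ∈ B, ∀ z ∈ S, bm p.1 z = p.2 → bm p'.1 z = p'.2 → p = p') :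
    Function.Injective
      (Matrix.of fun (p : ↥B) (z : ↥S) => if bm p.1.1 z.1 = p.1.2 then (((L : ℝ) ^ d)⁻¹) ^ p.1.1 else 0)ᵀ.mulVec := by
  set Q : Matrix ↥B ↥S ℝ := Matrix.of fun (p : ↥B) (z : ↥S) =>
    if bm p.1.1 z.1 = p.1.2 then (((L : ℝ) ^ d)⁻¹) ^ p.1.1 else 0 with hQ
  have hL0 : (0 : ℝ) < L := by exact_mod_cast hL
  -- it suffices to treat the kernel
  suffices hker : ∀ u : ↥B → ℝ, Qᵀ.mulVec u = 0 → u = 0 by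
    intro u₁ u₂ h
    have h0 : Qᵀ.mulVec (u₁ - u₂) = 0 := by rw [Matrix.mulVec_sub, h, sub_self]
    exact sub_eq_zero.mp (hker _ h0)
  intro u hu
  funext p
  obtain ⟨z, hzS, hz⟩ := hmeet p.1 p.2
  have hrow := congrFun hu ⟨z, hzS⟩
  simp only [Matrix.mulVec, dotProduct, Matrix.transpose_apply, Pi.zero_apply] at hrow
  -- only the index `p` contributes at the site `z`
  rw [Finset.sum_eq_single p] at hrow
  · rw [hQ, Matrix.of_apply, if_pos hz] at hrow
    have hc : (((L : ℝ) ^ d)⁻¹) ^ p.1.1 ≠ 0 := by positivity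
    exact (mul_eq_zero.mp hrow).resolve_left hc
  · intro p' _ hp'
    rw [hQ, Matrix.of_apply]
    by_cases h' : bm p'.1.1 z = p'.1.2
    · exact absurd (Subtype.ext (hdisj p'.1 p'.2 p.1 p.2 z hzS h' hz)) hp'
    · rw [if_neg h', zero_mul]
  · intro hp
    exact absurd (Finset.mem_univ p) hp

/-! ## §5 The tower Gram matrix `Q·G′(1)·G′(1)·Qᵀ` is a unit (general `bm`) -/

open Classical in
/-- **[B6] p. 235 FOR THE FLAT DIRICHLET `G′(1)`: `Q′G′²Q′ᵀ` IS A UNIT ON THE TOWER SPACE** (`uᵀ(QG′G′Qᵀ)u = |G′Qᵀu|²`, `G′` symmetric and a unit,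
`Qᵀ` injective for disjoint towers meeting the region) — the existence of the letter `C = (Q′G′²Q′ᵀ)⁻¹` of (1.91) ∕ [4] (3.25) at `U₀ = 1`.
[cite: Balaban1985RegularSpaces, (1.91) p.91; Balaban1984PropagatorsII, p.235; Balaban1985BackgroundPropagators, (3.25) p.394] -/
theorem isUnit_towerGram_bm (hd : 0 < d) {η : ℝ} (hη : η ≠ 0) {L : ℕ} (hL : 1 ≤ L) (m : ℕ) (Λs : ℕ → Set (Fin d → ℤ)) (bm : ℕ → (Fin d → ℤ) → (Fin d → ℤ)) (a : ℕ → ℝ)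
    (ha : ∀ j, 0 ≤ a j) (K : (Fin d → ℤ) → (Fin d → ℤ) → ℝ)
    (hK : ∀ x z, K x z = ((η ^ 2)⁻¹ * ∑ μ : Fin d, ((2 : ℝ) * (if z = x then (1 : ℝ) else 0) - (if z = x + e μ then (1 : ℝ) else 0)
        - (if z = x - e μ then (1 : ℝ) else 0))) +
        (∑ j ∈ Finset.range (m + 1), (if bm j x ∈ Λs j ∧ bm j z = bm j x then
          a j * ((((L : ℝ) ^ d)⁻¹) ^ j) ^ 2 else 0)))
    (S : Finset (Fin d → ℤ)) (B : Finset (ℕ × (Fin d → ℤ)))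
    (hmeet : ∀ p ∈ B, ∃ z ∈ S, bm p.1 z = p.2)
    (hdisj : ∀ p ∈ B, ∀ p' ∈ B, ∀ z ∈ S, bm p.1 z = p.2 → bm p'.1 z = p'.2 → p = p') :
    IsUnit ((Matrix.of fun (p : ↥B) (z : ↥S) => if bm p.1.1 z.1 = p.1.2 then (((L : ℝ) ^ d)⁻¹) ^ p.1.1 else 0) *
      (Matrix.of fun x z : ↥S => K x.1 z.1)⁻¹ * (Matrix.of fun x z : ↥S => K x.1 z.1)⁻¹ *
      (Matrix.of fun (p : ↥B) (z : ↥S) => if bm p.1.1 z.1 = p.1.2 then (((L : ℝ) ^ d)⁻¹) ^ p.1.1 else 0)ᵀ) := by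
  set Q : Matrix ↥B ↥S ℝ := Matrix.of fun (p : ↥B) (z : ↥S) =>
    if bm p.1.1 z.1 = p.1.2 then (((L : ℝ) ^ d)⁻¹) ^ p.1.1 else 0 with hQ
  set T : Matrix ↥S ↥S ℝ := Matrix.of fun x z : ↥S => K x.1 z.1 with hT
  have hTunit : IsUnit T := isUnit_flatMatrix_bm hd hη L m Λs bm a ha K hK S
  have hGi : IsUnit T⁻¹ := (Matrix.isUnit_nonsing_inv_iff).mpr hTunit
  have hGi_inj : Function.Injective T⁻¹.mulVec := Matrix.mulVec_injective_iff_isUnit.mpr hGi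
  have hGi_symm : (T⁻¹)ᵀ = T⁻¹ := flatMatrix_inv_transpose_bm L m Λs bm a K hK S
  have hQT_inj := towerQT_mulVec_injective_bm (d := d) hL bm S B hmeet hdisj
  refine Matrix.mulVec_injective_iff_isUnit.mp ?_
  -- kernel argument
  suffices hker : ∀ u : ↥B → ℝ, (Q * T⁻¹ * T⁻¹ * Qᵀ).mulVec u = 0 → u = 0 by
    intro u₁ u₂ h
    have h0 : (Q * T⁻¹ * T⁻¹ * Qᵀ).mulVec (u₁ - u₂) = 0 := by rw [Matrix.mulVec_sub, h, sub_self]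
    exact sub_eq_zero.mp (hker _ h0)
  intro u hu
  -- `w = G′Qᵀu` has `|w|² = uᵀ(QG′G′Qᵀ)u = 0`
  set w : ↥S → ℝ := (T⁻¹ * Qᵀ).mulVec u with hw
  have hsplit : (Q * T⁻¹ * T⁻¹ * Qᵀ).mulVec u = (Q * T⁻¹).mulVec w := by
    rw [hw, Matrix.mulVec_mulVec, ← Matrix.mul_assoc]
  have hQG : Q * T⁻¹ = (T⁻¹ * Qᵀ)ᵀ := by
    rw [Matrix.transpose_mul, Matrix.transpose_transpose, hGi_symm]
  have hww : w ⬝ᵥ w = 0 := by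
    have h1 : u ⬝ᵥ ((Q * T⁻¹ * T⁻¹ * Qᵀ).mulVec u) = 0 := by rw [hu, dotProduct_zero]
    rw [hsplit, hQG, Matrix.dotProduct_mulVec, Matrix.vecMul_transpose] at h1
    rw [← hw] at h1
    exact h1
  have hw0 : w = 0 := dotProduct_self_eq_zero.mp hww
  have hQu : Qᵀ.mulVec u = 0 := by
    apply hGi_inj
    rw [Matrix.mulVec_zero, Matrix.mulVec_mulVec, ← hw, hw0]
  exact hQT_inj (by rw [hQu, Matrix.mulVec_zero])


/-! ## §6 The RECORD instances: centred labels `bm j := flmZ L j` -/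

open Classical in
/-- ★ **`G′(1)` EXISTS FOR THE RECORD BLOCKING**: the flat Dirichlet matrix with the centred labels `flmZ L j` (the kernel of `B8Eq191FlatStencilsRec.flatDirichletOpZ_eq_sum_of_supp`) is a unit.
[cite: Balaban1985RegularSpaces, (1.91) p.91, (1.95) p.92; Balaban1984PropagatorsII, p.235; Balaban1987RG1, (0.3) p.252] -/
theorem isUnit_flatMatrixZ (hd : 0 < d) {η : ℝ} (hη : η ≠ 0) (L m : ℕ) (Λs : ℕ → Set (Fin d → ℤ)) (a : ℕ → ℝ)
    (ha : ∀ j, 0 ≤ a j) (K : (Fin d → ℤ) → (Fin d → ℤ) → ℝ)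
    (hK : ∀ x z, K x z = ((η ^ 2)⁻¹ * ∑ μ : Fin d, ((2 : ℝ) * (if z = x then (1 : ℝ) else 0) - (if z = x + e μ then (1 : ℝ) else 0)
        - (if z = x - e μ then (1 : ℝ) else 0))) +
        (∑ j ∈ Finset.range (m + 1), (if flmZ L j x ∈ Λs j ∧ flmZ L j z = flmZ L j x then
          a j * ((((L : ℝ) ^ d)⁻¹) ^ j) ^ 2 else 0)))
    (S : Finset (Fin d → ℤ)) :
    IsUnit (Matrix.of fun x z : ↥S => K x.1 z.1) :=
  isUnit_flatMatrix_bm hd hη L m Λs (flmZ L) a ha K hK S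

open Classical in
/-- `G′(1)` for the record blocking is symmetric. [cite: Balaban1985RegularSpaces, (1.95) p.92; Balaban1985BackgroundPropagators, (3.24) p.394] -/
theorem flatMatrixZ_inv_transpose {η : ℝ} (L m : ℕ) (Λs : ℕ → Set (Fin d → ℤ)) (a : ℕ → ℝ) (K : (Fin d → ℤ) → (Fin d → ℤ) → ℝ)
    (hK : ∀ x z, K x z = ((η ^ 2)⁻¹ * ∑ μ : Fin d, ((2 : ℝ) * (if z = x then (1 : ℝ) else 0) - (if z = x + e μ then (1 : ℝ) else 0)
        - (if z = x - e μ then (1 : ℝ) else 0))) +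
        (∑ j ∈ Finset.range (m + 1), (if flmZ L j x ∈ Λs j ∧ flmZ L j z = flmZ L j x then
          a j * ((((L : ℝ) ^ d)⁻¹) ^ j) ^ 2 else 0)))
    (S : Finset (Fin d → ℤ)) :
    ((Matrix.of fun x z : ↥S => K x.1 z.1)⁻¹)ᵀ = (Matrix.of fun x z : ↥S => K x.1 z.1)⁻¹ :=
  flatMatrix_inv_transpose_bm L m Λs (flmZ L) a K hK S

open Classical in
/-- ★ **THE LETTER `C = (Q′G′²Q′ᵀ)⁻¹` EXISTS FOR THE RECORD BLOCKING**: the tower Gram matrix with the centred labels `flmZ L j` is a unit, for disjoint record towers meeting the region.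
[cite: Balaban1985RegularSpaces, (1.91) p.91; Balaban1984PropagatorsII, p.235; Balaban1985BackgroundPropagators, (3.25) p.394; Balaban1987RG1, (0.3) p.252] -/
theorem isUnit_towerGramZ (hd : 0 < d) {η : ℝ} (hη : η ≠ 0) {L : ℕ} (hL : 1 ≤ L) (m : ℕ) (Λs : ℕ → Set (Fin d → ℤ)) (a : ℕ → ℝ)
    (ha : ∀ j, 0 ≤ a j) (K : (Fin d → ℤ) → (Fin d → ℤ) → ℝ)
    (hK : ∀ x z, K x z = ((η ^ 2)⁻¹ * ∑ μ : Fin d, ((2 : ℝ) * (if z = x then (1 : ℝ) else 0) - (if z = x + e μ then (1 : ℝ) else 0)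
        - (if z = x - e μ then (1 : ℝ) else 0))) +
        (∑ j ∈ Finset.range (m + 1), (if flmZ L j x ∈ Λs j ∧ flmZ L j z = flmZ L j x then
          a j * ((((L : ℝ) ^ d)⁻¹) ^ j) ^ 2 else 0)))
    (S : Finset (Fin d → ℤ)) (B : Finset (ℕ × (Fin d → ℤ)))
    (hmeet : ∀ p ∈ B, ∃ z ∈ S, flmZ L p.1 z = p.2)
    (hdisj : ∀ p ∈ B, ∀ p' ∈ B, ∀ z ∈ S, flmZ L p.1 z = p.2 → flmZ L p'.1 z = p'.2 → p = p') :
    IsUnit ((Matrix.of fun (p : ↥B) (z : ↥S) => if flmZ L p.1.1 z.1 = p.1.2 then (((L : ℝ) ^ d)⁻¹) ^ p.1.1 else 0) *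
      (Matrix.of fun x z : ↥S => K x.1 z.1)⁻¹ * (Matrix.of fun x z : ↥S => K x.1 z.1)⁻¹ *
      (Matrix.of fun (p : ↥B) (z : ↥S) => if flmZ L p.1.1 z.1 = p.1.2 then (((L : ℝ) ^ d)⁻¹) ^ p.1.1 else 0)ᵀ) :=
  isUnit_towerGram_bm hd hη hL m Λs (flmZ L) a ha K hK S B hmeet hdisj

end Literature.MathematicalPhysics.QuantumFieldTheory.Balaban1983to89.B8Eq191FlatTowerGramRec
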